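import Literature.LinearAlgebra.Matrix.UnitarySingularLocusNull
import Literature.NumberTheory.Rogawski1990.EndoscopicEmbedding
import HarnessLib

/-!
# The `G`-singular set of the endoscopic group `H = U(2) × U(1)` of `U(3)` over a local field is Haar-null

Topic `NumberTheory/Rogawski1990`; namespace `Literature.NumberTheory.Rogawski1990`.  THEOREMS ONLY (no definition, no instance, no notation,
no named fact, no `sorry`), over ★ `Literature.LinearAlgebra.Matrix.UnitarySingularLocusNull` (the parameter torus `exists_atomless_measure_normOneTorus`,
closedness `isClosed_unitaryGroupOfForm`, and the pattern of proof), ★ `EndoscopicEmbedding` (`endoGL : GL₂ × GL₁ →* GL₃`, the `(* 0 *; 0 * 0; * 0 *)`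
pattern), ★ `MvPolynomialZeroSetNull` (shear criterion, zero sets of non-zero polynomials) and ★ `CubicDiscriminantDiagonalScaling` (the rank-`3`
discriminant polynomial `D` with `D(diag(t)·g) ≢ 0` for invertible `g`).

SETTING.  `K` a non-discrete locally compact second-countable Hausdorff topological field of characteristic `0` with its Borel σ-algebra, `σ : K →+* K`
a continuous involution moving some element, `ε_k → 0` non-zero `σ`-fixed scalars (a quadratic extension of local fields and its conjugation), and the
ENDOSCOPIC GROUP `H = U(σ, J₂) × U(σ, J₁)` (`J₂ ∈ M₂(K)` congruent over `K` to a diagonal form, `J₁ ∈ M₁(K)` arbitrary) with the product topology and a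
Borel structure on the product.  An element `(g, u) ∈ H` is `G`-REGULAR when its block image `ι(g, u) = (g₀₀ 0 g₀₁; 0 u 0; g₁₀ 0 g₁₁) ∈ GL₃(K)` (★ `endoGL`)
has separable characteristic polynomial `χ_g · (X − u)` [Rogawski1990, §4.3 p. 42: «`γ ∈ H` is called `G`-regular if `γ` is regular as an element of `G`»].

RESULT **`measure_setOf_not_separable_charpoly_endoGL_eq_zero`**: for every Haar measure `ν` on `H`, the set of NON-`G`-regular elements is `ν`-null;
packaged as **`exists_closed_null_superset_GSingular`** (a CLOSED superset of the `G`-singular locus, null for EVERY Haar measure — the form that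
transports along isomorphisms of topological groups).  This is the measure theory tacit in every `∫_H` manipulation of the endoscopic transfer that
restricts to `G`-regular `γ_H` (the Weyl integration formula on `H`, [Rogawski1990, §12.5 p. 182–183]; [HarishChandra1970, Lemma 42] for `G` itself).

PROOF (chart-free, the ★ `UnitarySingularLocusNull` device on the product group).  `S = {D(ι(g, u)) = 0}` with `D` the cubic discriminant polynomial of
★ `exists_mvPolynomial_discr_charpoly_fin_three` is closed and contains the `G`-singular locus ((a) there).  Shear along the parameter torus
`t ∈ U(1)³ ↦ (diag(t₀, t₂), (t₁)) ∈ H` with the atomless measure `μ₁^{⊗3}` of ★ §1: since `ι(diag(t₀, t₂), (t₁)) = diag(t₀, t₁, t₂)`, the fibre of `S` over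
`(g, u)` is `{t | D(diag(t)·ι(g, u)) = 0}` up to a `μ₁^{⊗3}`-null set, the zero set of a NON-ZERO polynomial ((b) there, `ι(g, u)` invertible), hence null
(★ `pi_zeroLocus_mvPolynomial_eq_zero`); the shear criterion ★ `measure_eq_zero_of_forall_shear_null` gives `ν S = 0`.  General `J₂`: transport along
`g ↦ T g T⁻¹` on the first factor (★ `unitaryGroupOfFormCongrOfEq`), under which `ι` is conjugated by `ι(T, 1)`.
Consumer: the `hodgecm-mathlib` cell, crux H413, brick (H2) «SINGULAR-NULL-H» of the «UP-TRANSFER» census (the `H_v`-side of [Rogawski1990, Lemma 12.5.1]).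

## References
* [Rogawski1990] J. D. Rogawski, *Automorphic Representations of Unitary Groups in Three Variables*, Ann. of Math. Stud. 123 (1990), §4.3 p. 42; §4.8 p. 53;
  §12.5 pp. 182–183.
* [HarishChandra1970] Harish-Chandra (notes by G. van Dijk), *Harmonic Analysis on Reductive p-adic Groups*, LNM 162 (1970), Lemma 42.
* [Folland1995] G. B. Folland, *A Course in Abstract Harmonic Analysis* (1995), §2.2, Prop. 2.4.
-/

set_option autoImplicit false

noncomputable section

open _root_.MeasureTheory _root_.MeasureTheory.Measure _root_.Topology Filter Set Function
open Literature.NumberTheory.Automorphic Literature.MeasureTheory.Constructions Literature.LinearAlgebra.Matrix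
open scoped Matrix MatrixGroups

namespace Literature.NumberTheory.Rogawski1990

/-! ## §1 Diagonal tori of `U(σ, diag h)` in any size; the block image of a pair of diagonal matrices -/

section Algebra

variable {K : Type*} [Field K] (σ : K →+* K)

/-- **The diagonal torus of `U(σ, diag h)`** (any finite index type): a unit with matrix `diag(t)`, `t_i σ(t_i) = 1`, preserves the diagonal form
`diag h` (`ᵗσ(diag t)·diag h·diag t = diag(σ(t) h t) = diag h`). [cite: Rogawski1990, §12.5 p. 182] -/
theorem mem_unitaryGroupOfForm_diagonal_of_coe_eq_diagonal {n : Type*} [Fintype n] [DecidableEq n] (h : n → K) {t : n → K}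
    (ht : ∀ i, t i * σ (t i) = 1) (D : GL n K) (hD : (D : Matrix n n K) = Matrix.diagonal t) :
    D ∈ unitaryGroupOfForm σ (Matrix.diagonal h) := by
  rw [mem_unitaryGroupOfForm_iff, hD, Matrix.diagonal_map (map_zero σ), Matrix.diagonal_transpose, Matrix.diagonal_mul_diagonal,
    Matrix.diagonal_mul_diagonal]
  congr 1
  funext i
  rw [mul_assoc, mul_comm (h i), ← mul_assoc, mul_comm (σ (t i)), ht i, one_mul]

/-- **`ι(diag(t₀, t₂), (t₁)) = diag(t₀, t₁, t₂)`**: the block image (★ `endoGL`, pattern `(* 0 *; 0 * 0; * 0 *)`) of a pair of diagonal matrices is the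
diagonal matrix with the middle entry coming from the `U(1)`-factor. [cite: Rogawski1990, §4.8 Case (a) p. 53] -/
theorem coe_endoGL_eq_diagonal (t : Fin 3 → K) (D₂ : GL (Fin 2) K) (D₁ : GL (Fin 1) K)
    (h₂ : (D₂ : Matrix (Fin 2) (Fin 2) K) = Matrix.diagonal ![t 0, t 2]) (h₁ : (D₁ : Matrix (Fin 1) (Fin 1) K) = Matrix.diagonal ![t 1]) :
    ((endoGL (D₂, D₁) : GL (Fin 3) K) : Matrix (Fin 3) (Fin 3) K) = Matrix.diagonal t := by
  rw [coe_endoGL_eq]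
  simp only [h₂, h₁]
  ext i j
  fin_cases i <;> fin_cases j <;> simp [Matrix.diagonal]

/-- `ι` is multiplicative on pairs: `ι(a g, b u) = ι(a, b) · ι(g, u)` on matrices. [cite: Rogawski1990, §4.8 Case (a) p. 53] -/
theorem coe_endoGL_mul_mul (a g : GL (Fin 2) K) (b u : GL (Fin 1) K) :
    ((endoGL (a * g, b * u) : GL (Fin 3) K) : Matrix (Fin 3) (Fin 3) K) =
      ((endoGL (a, b) : GL (Fin 3) K) : Matrix (Fin 3) (Fin 3) K) * ((endoGL (g, u) : GL (Fin 3) K) : Matrix (Fin 3) (Fin 3) K) := by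
  rw [← Units.val_mul, ← map_mul, Prod.mk_mul_mk]

/-- `ι` intertwines conjugation: `ι(T⁻¹ g T, S⁻¹ u S) = ι(T, S)⁻¹ · ι(g, u) · ι(T, S)`, so the characteristic polynomial of the block image is a
conjugation invariant of the pair. [cite: Rogawski1990, §4.8 Case (a) p. 53] -/
theorem charpoly_endoGL_conj (T g : GL (Fin 2) K) (S u : GL (Fin 1) K) :
    ((endoGL (T⁻¹ * g * T, S⁻¹ * u * S) : GL (Fin 3) K) : Matrix (Fin 3) (Fin 3) K).charpoly =
      ((endoGL (g, u) : GL (Fin 3) K) : Matrix (Fin 3) (Fin 3) K).charpoly := by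
  have h : endoGL (T⁻¹ * g * T, S⁻¹ * u * S) = (endoGL (T, S))⁻¹ * endoGL (g, u) * endoGL (T, S) := by
    rw [← map_inv, ← map_mul, ← map_mul, Prod.inv_mk, Prod.mk_mul_mk, Prod.mk_mul_mk]
  rw [h, Units.val_mul, Units.val_mul, Matrix.coe_units_inv, Matrix.charpoly_units_conj']

end Algebra

/-! ## §2 The diagonal-form case: shear along `U(1)³` -/

section Diagonal

variable {K : Type*} [Field K] [TopologicalSpace K] [IsTopologicalRing K] (σ : K →+* K) (hσc : Continuous σ)
  [ContinuousInv₀ K] [T2Space K] [LocallyCompactSpace K] [SecondCountableTopology K] [MeasurableSpace K] [BorelSpace K] [CharZero K]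

include hσc in
/-- **The diagonal-form case.**  `σ` a continuous involution of the characteristic-`0` local field `K` moving some `a`, `ε_k → 0` non-zero `σ`-fixed;
`h₂ ∈ K²`, `h₁ ∈ K¹`.  On `H = U(σ, diag h₂) × U(σ, diag h₁)` there is a CLOSED subset `S` containing every pair `(g, u)` whose block image `ι(g, u)` has
non-separable characteristic polynomial (the non-`G`-regular elements) and NULL for every Haar measure on `H`.  (`S = {D(ι(g, u)) = 0}` for the cubic
discriminant polynomial `D` of ★ `exists_mvPolynomial_discr_charpoly_fin_three`; shear along `t ↦ (diag(t₀, t₂), (t₁))`, `t ∈ U(1)³`, with the atomless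
parameter measure of ★ `exists_atomless_measure_normOneTorus`; every fibre is the zero set of the non-zero polynomial `t ↦ D(diag(t)·ι(g, u))`.)
[cite: Rogawski1990, §4.3 p. 42; §12.5 p. 182] [cite: HarishChandra1970, Lemma 42] -/
theorem exists_closed_null_superset_GSingular_diagonal (hσσ : ∀ x, σ (σ x) = x) {a : K} (ha : σ a ≠ a)
    {ε : ℕ → K} (hε : Tendsto ε atTop (𝓝 0)) (hε0 : ∀ k, ε k ≠ 0) (hσε : ∀ k, σ (ε k) = ε k) (h₂ : Fin 2 → K) (h₁ : Fin 1 → K)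
    [MeasurableSpace (↥(unitaryGroupOfForm σ (Matrix.diagonal h₂)) × ↥(unitaryGroupOfForm σ (Matrix.diagonal h₁)))]
    [BorelSpace (↥(unitaryGroupOfForm σ (Matrix.diagonal h₂)) × ↥(unitaryGroupOfForm σ (Matrix.diagonal h₁)))] :
    ∃ S : Set (↥(unitaryGroupOfForm σ (Matrix.diagonal h₂)) × ↥(unitaryGroupOfForm σ (Matrix.diagonal h₁))), IsClosed S ∧
      (∀ p : ↥(unitaryGroupOfForm σ (Matrix.diagonal h₂)) × ↥(unitaryGroupOfForm σ (Matrix.diagonal h₁)),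
        ¬ ((endoGL ((p.1 : GL (Fin 2) K), (p.2 : GL (Fin 1) K)) : GL (Fin 3) K) : Matrix (Fin 3) (Fin 3) K).charpoly.Separable → p ∈ S) ∧
      ∀ ν : Measure (↥(unitaryGroupOfForm σ (Matrix.diagonal h₂)) × ↥(unitaryGroupOfForm σ (Matrix.diagonal h₁))), ν.IsHaarMeasure → ν S = 0 := by
  classical
  obtain ⟨Dp, hDa, hDb⟩ := exists_mvPolynomial_discr_charpoly_fin_three K
  -- topology of the two factors and of `H`
  haveI : ∀ m : ℕ, SecondCountableTopology (Matrix (Fin m) (Fin m) K) := fun m => inferInstanceAs (SecondCountableTopology (Fin m → Fin m → K))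
  haveI : ∀ m : ℕ, SecondCountableTopology (Matrix (Fin m) (Fin m) K)ᵐᵒᵖ := fun m => MulOpposite.opHomeomorph.symm.secondCountableTopology
  haveI : ∀ m : ℕ, SecondCountableTopology (GL (Fin m) K) := fun m => Units.isEmbedding_embedProduct.secondCountableTopology
  haveI : SecondCountableTopology ↥(unitaryGroupOfForm σ (Matrix.diagonal h₂)) := TopologicalSpace.Subtype.secondCountableTopology _
  haveI : SecondCountableTopology ↥(unitaryGroupOfForm σ (Matrix.diagonal h₁)) := TopologicalSpace.Subtype.secondCountableTopology _
  haveI : ∀ m : ℕ, LocallyCompactSpace (Matrix (Fin m) (Fin m) K) := fun m => inferInstanceAs (LocallyCompactSpace (Fin m → Fin m → K))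
  haveI : ∀ m : ℕ, LocallyCompactSpace (GL (Fin m) K) := fun m => inferInstance
  haveI : LocallyCompactSpace ↥(unitaryGroupOfForm σ (Matrix.diagonal h₂)) :=
    (isClosed_unitaryGroupOfForm σ hσc (Matrix.diagonal h₂)).isClosedEmbedding_subtypeVal.locallyCompactSpace
  haveI : LocallyCompactSpace ↥(unitaryGroupOfForm σ (Matrix.diagonal h₁)) :=
    (isClosed_unitaryGroupOfForm σ hσc (Matrix.diagonal h₁)).isClosedEmbedding_subtypeVal.locallyCompactSpace
  -- the closed superset `S = {Φ = 0}`
  let M : ↥(unitaryGroupOfForm σ (Matrix.diagonal h₂)) × ↥(unitaryGroupOfForm σ (Matrix.diagonal h₁)) → Matrix (Fin 3) (Fin 3) K :=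
    fun p => ((endoGL ((p.1 : GL (Fin 2) K), (p.2 : GL (Fin 1) K)) : GL (Fin 3) K) : Matrix (Fin 3) (Fin 3) K)
  have hMc : Continuous M :=
    Units.continuous_val.comp (continuous_endoGL.comp
      ((continuous_subtype_val.comp continuous_fst).prodMk (continuous_subtype_val.comp continuous_snd)))
  let Φ : ↥(unitaryGroupOfForm σ (Matrix.diagonal h₂)) × ↥(unitaryGroupOfForm σ (Matrix.diagonal h₁)) → K :=
    fun p => MvPolynomial.eval (fun ij : Fin 3 × Fin 3 => M p ij.1 ij.2) Dp
  have hΦc : Continuous Φ :=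
    (MvPolynomial.continuous_eval Dp).comp (continuous_pi fun ij : Fin 3 × Fin 3 => hMc.matrix_elem ij.1 ij.2)
  have hSm : MeasurableSet (Φ ⁻¹' {0}) := (isClosed_singleton.preimage hΦc).measurableSet
  refine ⟨Φ ⁻¹' {0}, isClosed_singleton.preimage hΦc, fun p hp => ?_, fun ν hν => ?_⟩
  · by_contra hne
    exact hp (hDa _ hne)
  -- the parameter measure `μ = μ₁^{⊗3}`
  obtain ⟨μ₁, hfin, hne, hatom, hconc⟩ := exists_atomless_measure_normOneTorus σ hσc hσσ ha hε hε0 hσε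
  haveI := hfin
  haveI := hatom
  set μ : Measure (Fin 3 → K) := Measure.pi (fun _ : Fin 3 => μ₁) with hμ
  have hμ0 : μ ≠ 0 := by
    intro h0
    have h1 : μ univ = 0 := by rw [h0, Measure.coe_zero, Pi.zero_apply]
    rw [hμ, Measure.pi_univ, Finset.prod_const] at h1
    exact pow_ne_zero _ (Measure.measure_univ_ne_zero.mpr hne) h1
  -- the parameter torus `ι : t ↦ (diag(t₀, t₂), (t₁))`
  set C : Set (Fin 3 → K) := {t | ∀ i, t i * σ (t i) = 1} with hC
  have hCcl : IsClosed C := by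
    have hC' : C = ⋂ i, {t : Fin 3 → K | t i * σ (t i) = 1} := by
      ext t
      simp only [hC, mem_setOf_eq, mem_iInter]
    rw [hC']
    exact isClosed_iInter fun i => isClosed_eq ((continuous_apply i).mul (hσc.comp (continuous_apply i))) continuous_const
  have hCne : ∀ t ∈ C, ∀ i, t i ≠ 0 := fun t ht i h0 => by
    have h1 := ht i
    rw [h0, zero_mul] at h1
    exact zero_ne_one h1
  have ht₂ : ∀ t ∈ C, ∀ i, (![t 0, t 2] : Fin 2 → K) i * σ ((![t 0, t 2] : Fin 2 → K) i) = 1 := fun t ht i => by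
    fin_cases i
    · exact ht 0
    · exact ht 2
  have ht₁ : ∀ t ∈ C, ∀ i, (![t 1] : Fin 1 → K) i * σ ((![t 1] : Fin 1 → K) i) = 1 := fun t ht i => by
    fin_cases i
    exact ht 1
  have hdet₂ : ∀ t ∈ C, (Matrix.diagonal ![t 0, t 2]).det ≠ 0 := fun t ht => by
    rw [Matrix.det_diagonal]
    exact Finset.prod_ne_zero_iff.mpr fun i _ => by fin_cases i <;> [exact hCne t ht 0; exact hCne t ht 2]
  have hdet₁ : ∀ t ∈ C, (Matrix.diagonal ![t 1]).det ≠ 0 := fun t ht => by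
    rw [Matrix.det_diagonal]
    exact Finset.prod_ne_zero_iff.mpr fun i _ => by fin_cases i; exact hCne t ht 1
  have hmem₂ : ∀ t (ht : t ∈ C), Matrix.GeneralLinearGroup.mkOfDetNeZero (Matrix.diagonal ![t 0, t 2]) (hdet₂ t ht) ∈
      unitaryGroupOfForm σ (Matrix.diagonal h₂) := fun t ht =>
    mem_unitaryGroupOfForm_diagonal_of_coe_eq_diagonal σ h₂ (ht₂ t ht) _ rfl
  have hmem₁ : ∀ t (ht : t ∈ C), Matrix.GeneralLinearGroup.mkOfDetNeZero (Matrix.diagonal ![t 1]) (hdet₁ t ht) ∈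
      unitaryGroupOfForm σ (Matrix.diagonal h₁) := fun t ht =>
    mem_unitaryGroupOfForm_diagonal_of_coe_eq_diagonal σ h₁ (ht₁ t ht) _ rfl
  let ι₀ : ↥C → ↥(unitaryGroupOfForm σ (Matrix.diagonal h₂)) × ↥(unitaryGroupOfForm σ (Matrix.diagonal h₁)) := fun t =>
    (⟨Matrix.GeneralLinearGroup.mkOfDetNeZero (Matrix.diagonal ![t.1 0, t.1 2]) (hdet₂ t.1 t.2), hmem₂ t.1 t.2⟩,
     ⟨Matrix.GeneralLinearGroup.mkOfDetNeZero (Matrix.diagonal ![t.1 1]) (hdet₁ t.1 t.2), hmem₁ t.1 t.2⟩)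
  -- continuity of `ι₀`: each factor through `Units.continuous_iff` (matrix and inverse matrix continuous in `t`)
  have hdiag_cont : ∀ {m : ℕ} (s : Fin m → Fin 3), Continuous fun t : ↥C => Matrix.diagonal fun i => t.1 (s i) := fun s =>
    (continuous_pi fun i => (continuous_apply (s i)).comp continuous_subtype_val).matrix_diagonal
  have hdiag_inv_cont : ∀ {m : ℕ} (s : Fin m → Fin 3), Continuous fun t : ↥C => Matrix.diagonal fun i => (t.1 (s i))⁻¹ := fun s =>
    (continuous_pi fun i => ((continuous_apply (s i)).comp continuous_subtype_val).inv₀ fun t => hCne t.1 t.2 (s i)).matrix_diagonal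
  have hinv_eq : ∀ {m : ℕ} (s : Fin m → Fin 3) (t : ↥C) (hd : (Matrix.diagonal fun i => t.1 (s i)).det ≠ 0),
      (((Matrix.GeneralLinearGroup.mkOfDetNeZero (Matrix.diagonal fun i => t.1 (s i)) hd)⁻¹ : GL (Fin m) K) : Matrix (Fin m) (Fin m) K) =
        Matrix.diagonal fun i => (t.1 (s i))⁻¹ := fun s t hd => by
    rw [Matrix.coe_units_inv]
    refine Matrix.inv_eq_left_inv ?_
    show (Matrix.diagonal fun i => (t.1 (s i))⁻¹) * Matrix.diagonal (fun i => t.1 (s i)) = 1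
    rw [Matrix.diagonal_mul_diagonal, ← Matrix.diagonal_one]
    congr 1
    funext i
    exact inv_mul_cancel₀ (hCne t.1 t.2 (s i))
  have hv₂ : ∀ t : Fin 3 → K, (![t 0, t 2] : Fin 2 → K) = fun i => t (![0, 2] i) := fun t => by
    funext i; fin_cases i <;> rfl
  have hv₁ : ∀ t : Fin 3 → K, (![t 1] : Fin 1 → K) = fun i => t (![1] i) := fun t => by
    funext i; fin_cases i; rfl
  have hι₀c : Continuous ι₀ := by
    refine Continuous.prodMk (Continuous.subtype_mk ?_ _) (Continuous.subtype_mk ?_ _)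
    · rw [Units.continuous_iff]
      refine ⟨?_, ?_⟩
      · show Continuous fun t : ↥C => Matrix.diagonal ![t.1 0, t.1 2]
        simp only [hv₂]
        exact hdiag_cont ![0, 2]
      · have h2 : (fun t : ↥C => (((Matrix.GeneralLinearGroup.mkOfDetNeZero (Matrix.diagonal ![t.1 0, t.1 2]) (hdet₂ t.1 t.2))⁻¹ :
              GL (Fin 2) K) : Matrix (Fin 2) (Fin 2) K)) = fun t : ↥C => Matrix.diagonal fun i => (t.1 (![0, 2] i))⁻¹ := by
          funext t
          have hd : (Matrix.diagonal fun i => t.1 (![0, 2] i)).det ≠ 0 := by rw [← hv₂]; exact hdet₂ t.1 t.2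
          have := hinv_eq ![0, 2] t hd
          simp only [← hv₂] at this
          exact this
        rw [h2]
        exact hdiag_inv_cont ![0, 2]
    · rw [Units.continuous_iff]
      refine ⟨?_, ?_⟩
      · show Continuous fun t : ↥C => Matrix.diagonal ![t.1 1]
        simp only [hv₁]
        exact hdiag_cont ![1]
      · have h2 : (fun t : ↥C => (((Matrix.GeneralLinearGroup.mkOfDetNeZero (Matrix.diagonal ![t.1 1]) (hdet₁ t.1 t.2))⁻¹ :
              GL (Fin 1) K) : Matrix (Fin 1) (Fin 1) K)) = fun t : ↥C => Matrix.diagonal fun i => (t.1 (![1] i))⁻¹ := by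
          funext t
          have hd : (Matrix.diagonal fun i => t.1 (![1] i)).det ≠ 0 := by rw [← hv₁]; exact hdet₁ t.1 t.2
          have := hinv_eq ![1] t hd
          simp only [← hv₁] at this
          exact this
        rw [h2]
        exact hdiag_inv_cont ![1]
  set ι : (Fin 3 → K) → ↥(unitaryGroupOfForm σ (Matrix.diagonal h₂)) × ↥(unitaryGroupOfForm σ (Matrix.diagonal h₁)) :=
    fun t => if ht : t ∈ C then ι₀ ⟨t, ht⟩ else 1 with hι
  have hιm : Measurable ι := Measurable.dite hι₀c.measurable measurable_const hCcl.measurableSet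
  -- σ-finiteness of the Haar measure `ν`
  haveI : SigmaCompactSpace (↥(unitaryGroupOfForm σ (Matrix.diagonal h₂)) × ↥(unitaryGroupOfForm σ (Matrix.diagonal h₁))) :=
    sigmaCompactSpace_of_locallyCompact_secondCountable
  haveI : SigmaFinite ν := inferInstance
  refine measure_eq_zero_of_forall_shear_null ν μ hμ0 hιm hSm fun p => ?_
  -- the fibre over `p = (g, u)`: inside `Cᶜ ∪ {t | R(t) = 0}` with `R ≠ 0`
  set gm : Matrix (Fin 3) (Fin 3) K := M p with hgm
  have hgdet : gm.det ≠ 0 := Matrix.GeneralLinearGroup.det_ne_zero _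
  obtain ⟨t₀, ht₀⟩ := hDb gm hgdet
  set R : MvPolynomial (Fin 3) K :=
    MvPolynomial.bind₁ (fun ij : Fin 3 × Fin 3 => MvPolynomial.X ij.1 * MvPolynomial.C (gm ij.1 ij.2)) Dp with hR
  have hRev : ∀ t : Fin 3 → K,
      MvPolynomial.eval t R = MvPolynomial.eval (fun ij : Fin 3 × Fin 3 => (Matrix.diagonal t * gm) ij.1 ij.2) Dp := by
    intro t
    have h1 : MvPolynomial.eval t R =
        MvPolynomial.eval (fun ij : Fin 3 × Fin 3 => MvPolynomial.eval t (MvPolynomial.X ij.1 * MvPolynomial.C (gm ij.1 ij.2))) Dp := by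
      rw [hR]
      exact MvPolynomial.eval₂Hom_bind₁ _ _ _ _
    have h2 : (fun ij : Fin 3 × Fin 3 => MvPolynomial.eval t (MvPolynomial.X ij.1 * MvPolynomial.C (gm ij.1 ij.2))) =
        fun ij : Fin 3 × Fin 3 => (Matrix.diagonal t * gm) ij.1 ij.2 := by
      funext ij
      rw [map_mul, MvPolynomial.eval_X, MvPolynomial.eval_C, Matrix.diagonal_mul]
    rw [h1, h2]
  have hR0 : R ≠ 0 := fun h0 => ht₀ (by rw [← hRev, h0, map_zero])
  have hnull : μ {t : Fin 3 → K | MvPolynomial.eval t R = 0} = 0 := by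
    have h1 := pi_zeroLocus_mvPolynomial_eq_zero (K := K) (X := K) (e := id) measurable_id injective_id μ₁ 3 R hR0
    simpa only [id] using h1
  have hCc : μ Cᶜ = 0 := by
    have hsub : Cᶜ ⊆ ⋃ i : Fin 3, Function.eval i ⁻¹' {u : K | u * σ u = 1}ᶜ := by
      intro t ht
      simp only [hC, mem_compl_iff, mem_setOf_eq, not_forall] at ht
      obtain ⟨i, hi⟩ := ht
      exact mem_iUnion.2 ⟨i, hi⟩
    exact measure_mono_null hsub (measure_iUnion_null fun i => Measure.pi_eval_preimage_null (fun _ : Fin 3 => μ₁) hconc)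
  refine measure_mono_null (fun t ht => ?_) (measure_union_null hCc hnull)
  by_cases htC : t ∈ C
  · refine Or.inr ?_
    simp only [mem_setOf_eq] at ht ⊢
    rw [hRev]
    -- `ι(ι t · p) = diag(t) · ι(p)`
    have hdiag : ((endoGL (((ι t).1 : GL (Fin 2) K), ((ι t).2 : GL (Fin 1) K)) : GL (Fin 3) K) : Matrix (Fin 3) (Fin 3) K) = Matrix.diagonal t := by
      rw [hι]
      simp only [dif_pos htC]
      exact coe_endoGL_eq_diagonal t _ _ rfl rfl
    have hval : M (ι t * p) = Matrix.diagonal t * gm := by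
      show ((endoGL (((ι t * p).1 : GL (Fin 2) K), ((ι t * p).2 : GL (Fin 1) K)) : GL (Fin 3) K) : Matrix (Fin 3) (Fin 3) K) = _
      rw [Prod.fst_mul, Prod.snd_mul, Subgroup.coe_mul, Subgroup.coe_mul, coe_endoGL_mul_mul, hdiag]
    have ht' : Φ (ι t * p) = 0 := ht
    simpa only [Φ, hval] using ht'
  · exact Or.inl htC

end Diagonal

/-! ## §3 General forms: `J₂` congruent to a diagonal form, `J₁` arbitrary -/

section General

variable {K : Type*} [Field K] [TopologicalSpace K] [IsTopologicalRing K] (σ : K →+* K) (hσc : Continuous σ)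
  [ContinuousInv₀ K] [T2Space K] [LocallyCompactSpace K] [SecondCountableTopology K] [MeasurableSpace K] [BorelSpace K] [CharZero K]

omit [TopologicalSpace K] [IsTopologicalRing K] [ContinuousInv₀ K] [T2Space K] [LocallyCompactSpace K] [SecondCountableTopology K]
  [MeasurableSpace K] [BorelSpace K] [CharZero K] in
/-- A `1 × 1` form is diagonal: `formCongr σ 1 J₁ = diag(J₁ 0 0)` (private plumbing for the `U(1)`-factor). [folklore] -/
private theorem formCongr_one_fin_one (J₁ : Matrix (Fin 1) (Fin 1) K) : formCongr σ 1 J₁ = Matrix.diagonal ![J₁ 0 0] := by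
  dsimp only [formCongr]
  rw [Units.val_one, Matrix.map_one σ (map_zero σ) (map_one σ), Matrix.transpose_one, Matrix.one_mul, Matrix.mul_one]
  ext i j
  fin_cases i; fin_cases j
  rfl

include hσc in
/-- **A CLOSED, HAAR-NULL SUPERSET OF THE `G`-SINGULAR LOCUS OF `H = U(σ, J₂) × U(σ, J₁)`** (`J₂ ∈ M₂(K)` congruent over `K` to a diagonal form,
`formCongr σ T J₂ = diag h₂`; `J₁ ∈ M₁(K)` arbitrary; `σ` a continuous involution of the characteristic-`0` local field `K` with `σ a ≠ a`, `ε_k → 0` non-zero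
`σ`-fixed): there is a closed `S ⊆ H` containing every `(g, u)` whose block image `ι(g, u) ∈ GL₃(K)` has non-separable characteristic polynomial, with
`ν S = 0` for every Haar measure `ν` on `H`.  Transport of the diagonal case along `(g, u) ↦ (T g T⁻¹, u)` (★ `unitaryGroupOfFormCongrOfEq` on each factor;
`ι` is conjugated by `ι(T, 1)`, Haar measures are preserved). [cite: Rogawski1990, §4.3 p. 42; §12.5 p. 182] [cite: HarishChandra1970, Lemma 42] -/
theorem exists_closed_null_superset_GSingular (hσσ : ∀ x, σ (σ x) = x) {a : K} (ha : σ a ≠ a)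
    {ε : ℕ → K} (hε : Tendsto ε atTop (𝓝 0)) (hε0 : ∀ k, ε k ≠ 0) (hσε : ∀ k, σ (ε k) = ε k)
    {J₂ : Matrix (Fin 2) (Fin 2) K} {T : GL (Fin 2) K} {h₂ : Fin 2 → K} (hT : formCongr σ T J₂ = Matrix.diagonal h₂) (J₁ : Matrix (Fin 1) (Fin 1) K)
    [MeasurableSpace (↥(unitaryGroupOfForm σ J₂) × ↥(unitaryGroupOfForm σ J₁))] [BorelSpace (↥(unitaryGroupOfForm σ J₂) × ↥(unitaryGroupOfForm σ J₁))] :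
    ∃ S : Set (↥(unitaryGroupOfForm σ J₂) × ↥(unitaryGroupOfForm σ J₁)), IsClosed S ∧
      (∀ p : ↥(unitaryGroupOfForm σ J₂) × ↥(unitaryGroupOfForm σ J₁),
        ¬ ((endoGL ((p.1 : GL (Fin 2) K), (p.2 : GL (Fin 1) K)) : GL (Fin 3) K) : Matrix (Fin 3) (Fin 3) K).charpoly.Separable → p ∈ S) ∧
      ∀ ν : Measure (↥(unitaryGroupOfForm σ J₂) × ↥(unitaryGroupOfForm σ J₁)), ν.IsHaarMeasure → ν S = 0 := by
  letI : MeasurableSpace (↥(unitaryGroupOfForm σ (Matrix.diagonal h₂)) × ↥(unitaryGroupOfForm σ (Matrix.diagonal ![J₁ 0 0]))) := borel _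
  haveI : BorelSpace (↥(unitaryGroupOfForm σ (Matrix.diagonal h₂)) × ↥(unitaryGroupOfForm σ (Matrix.diagonal ![J₁ 0 0]))) := ⟨rfl⟩
  obtain ⟨S₀, hS₀c, hS₀sing, hS₀null⟩ := exists_closed_null_superset_GSingular_diagonal σ hσc hσσ ha hε hε0 hσε h₂ ![J₁ 0 0]
  -- `e : U(σ, diag h₂) × U(σ, diag (J₁ 0 0)) ≃ₜ* U(σ, J₂) × U(σ, J₁)`, `(g, u) ↦ (T g T⁻¹, u)`
  set e₂ := unitaryGroupOfFormCongrOfEq σ T J₂ (Matrix.diagonal h₂) hT with he₂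
  set e₁ := unitaryGroupOfFormCongrOfEq σ 1 J₁ (Matrix.diagonal ![J₁ 0 0]) (formCongr_one_fin_one σ J₁) with he₁
  let e : (↥(unitaryGroupOfForm σ (Matrix.diagonal h₂)) × ↥(unitaryGroupOfForm σ (Matrix.diagonal ![J₁ 0 0]))) ≃ₜ*
      (↥(unitaryGroupOfForm σ J₂) × ↥(unitaryGroupOfForm σ J₁)) :=
    { MulEquiv.prodCongr e₂.toMulEquiv e₁.toMulEquiv with
      continuous_toFun := (e₂.continuous.comp continuous_fst).prodMk (e₁.continuous.comp continuous_snd)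
      continuous_invFun := (e₂.symm.continuous.comp continuous_fst).prodMk (e₁.symm.continuous.comp continuous_snd) }
  have he_symm : ∀ p, e.symm p = (e₂.symm p.1, e₁.symm p.2) := fun _ => rfl
  refine ⟨e.symm ⁻¹' S₀, hS₀c.preimage e.symm.continuous, fun p hp => ?_, fun ν hν => ?_⟩
  · -- `(T⁻¹ g T, u)` is `G`-singular with `(g, u)`
    refine hS₀sing (e.symm p) fun hsep => hp ?_
    have h1 : (((e.symm p).1 : GL (Fin 2) K)) = T⁻¹ * (p.1 : GL (Fin 2) K) * T := by
      rw [he_symm, he₂, coe_unitaryGroupOfFormCongrOfEq_symm_apply]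
    have h2 : (((e.symm p).2 : GL (Fin 1) K)) = (1 : GL (Fin 1) K)⁻¹ * (p.2 : GL (Fin 1) K) * 1 := by
      rw [he_symm, he₁, coe_unitaryGroupOfFormCongrOfEq_symm_apply]
    rw [h1, h2, charpoly_endoGL_conj] at hsep
    exact hsep
  · haveI : (ν.map e.symm).IsHaarMeasure := ContinuousMulEquiv.isHaarMeasure_map ν e.symm
    have h1 := hS₀null (ν.map e.symm) inferInstance
    have hm : Measurable (e.symm : ↥(unitaryGroupOfForm σ J₂) × ↥(unitaryGroupOfForm σ J₁) →
        ↥(unitaryGroupOfForm σ (Matrix.diagonal h₂)) × ↥(unitaryGroupOfForm σ (Matrix.diagonal ![J₁ 0 0]))) :=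
      e.symm.continuous.measurable
    rwa [Measure.map_apply hm hS₀c.measurableSet] at h1

include hσc in
/-- **THE `G`-SINGULAR SET OF `H = U(σ, J₂) × U(σ, J₁)` IS HAAR-NULL** (`J₂` congruent over `K` to a diagonal form, `J₁ ∈ M₁(K)`; `σ` a continuous involution of
the characteristic-`0` local field `K` moving some element, with a `σ`-fixed null sequence of non-zero scalars): for every Haar measure `ν` on `H`, the pairs
`(g, u)` whose block image `ι(g, u) = (g₀₀ 0 g₀₁; 0 u 0; g₁₀ 0 g₁₁)` has NON-separable characteristic polynomial `χ_g · (X − u)` — the non-`G`-regular elements of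
`H` — form a `ν`-null set.  «`G`-regular elements are dense ∕ of full measure in `H`», the measure theory behind the `H`-side Weyl integration formula of the
endoscopic transfer. [cite: Rogawski1990, §4.3 p. 42; §12.5 pp. 182–183] [cite: HarishChandra1970, Lemma 42] -/
theorem measure_setOf_not_separable_charpoly_endoGL_eq_zero (hσσ : ∀ x, σ (σ x) = x) {a : K} (ha : σ a ≠ a)
    {ε : ℕ → K} (hε : Tendsto ε atTop (𝓝 0)) (hε0 : ∀ k, ε k ≠ 0) (hσε : ∀ k, σ (ε k) = ε k)
    {J₂ : Matrix (Fin 2) (Fin 2) K} {T : GL (Fin 2) K} {h₂ : Fin 2 → K} (hT : formCongr σ T J₂ = Matrix.diagonal h₂) (J₁ : Matrix (Fin 1) (Fin 1) K)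
    [MeasurableSpace (↥(unitaryGroupOfForm σ J₂) × ↥(unitaryGroupOfForm σ J₁))] [BorelSpace (↥(unitaryGroupOfForm σ J₂) × ↥(unitaryGroupOfForm σ J₁))]
    (ν : Measure (↥(unitaryGroupOfForm σ J₂) × ↥(unitaryGroupOfForm σ J₁))) [ν.IsHaarMeasure] :
    ν {p : ↥(unitaryGroupOfForm σ J₂) × ↥(unitaryGroupOfForm σ J₁) |
        ¬ ((endoGL ((p.1 : GL (Fin 2) K), (p.2 : GL (Fin 1) K)) : GL (Fin 3) K) : Matrix (Fin 3) (Fin 3) K).charpoly.Separable} = 0 := by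
  obtain ⟨S, -, hSsing, hSnull⟩ := exists_closed_null_superset_GSingular σ hσc hσσ ha hε hε0 hσε hT J₁
  exact measure_mono_null (fun p hp => hSsing p hp) (hSnull ν inferInstance)

end General

end Literature.NumberTheory.Rogawski1990

end
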